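/-
Copyright (c) 2026. All rights reserved.
Released under Apache 2.0 license as described in the file LICENSE.
-/
import Literature.Probability.LatticeModels.PinningMeasurability
import Literature.Probability.LatticeModels.FlipReflectionDomination
import Literature.Probability.LatticeModels.GibbsStrongMarkov
import Literature.Probability.LatticeModels.StripWetting
import Literature.Probability.LatticeModels.LineTouching
import HarnessLib

/-!
# The pinning lemma (Georgii–Higuchi 2000, Lemma 5.2), probability part

Georgii–Higuchi, *Percolation and number of phases in the 2D Ising model*, J. Math. Phys. 41
(2000), Lemma 5.2 ("pinning lemma"): for `β > β_c`, `μ ∈ 𝒢(β, 0)`, a box `Δ = Λ_m` and a site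
`x` of the left half-axis `ℓ_left` far from the origin, with probability bounded below (by a
quarter of the `+∗`percolation probability) `x` is `+∗`connected *in `(Δ ∪ ℓ_left,far)ᶜ`* to the
infinite `+∗`structure `J` of the upper half-plane — provided `J` touches the axis on both sides
of `x`.

This file proves the probability half of the lemma for the contour-free exploration domain
`pinDom m L ω` of `PinningDomain`/`PinningDomainStopping` (which replaces GH's "semicircuit with
the largest interior"):

* `PinLeft m x ω` — the pinning event: a `+∗`walk from `x` to a `J`-site, outside `Λ_m`, all of
  whose axis sites lie at columns `< -m` (exactly the shape `hPx` consumed by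
  `Percolation.upperType_append`);
* `pinLeft_of_mem_kSet` — (deterministic) if `x` is `+∗`connected inside the domain to its upper
  boundary then `PinLeft` holds (the boundary of the domain above the axis is part of `J`,
  `PinningDomain.exists_attach`; the domain avoids `Λ_m` and the far half-axis);
* `mem_pinDom_or_pinK_of_starArc` — (deterministic, the eye lemma) if two `K`-sites of the axis on
  either side of `x` are joined by a `∗`-walk of `K`-sites then `x` lies in the domain or in `K`;
* `measureReal_kSet_pinDom_ge` — **the strong Markov step**:
  `θ⁺(x)/2 · μ(x ∈ pinDom) ≤ μ(x ∈ kSet (pinDom) 1)`, by the strong Markov property of `μ` at the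
  outside-determined random volume `pinDom` (`measurableSet_cylinderEvents_pinDom_eq`), monotonicity
  in the boundary condition (`+` on the upper boundary, anything `≥ -` on the lower one) and the
  point-to-semicircuit lemma `pointToSemicircuit` (GH Lemma 2.3) in the reflection-symmetric,
  hole-free volume `pinDom`;
* `measureReal_pinLeft_ge` — the resulting bound `θ⁺(x)/2 · μ(SemiLeft m L x) ≤ 2 μ(PinLeft m x)`;
* `measureReal_semiLeft_eventually_ge`, `measureReal_leftAnchored_ge` — the semicircuit event has,
  for `L` large, probability close to that of the anchoring event `LeftAnchored m x` ("`J` has an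
  axis site right of `x` whose cluster has one left of `x`"), which is close to
  `μ(LeftAnchoredInf m)` ("some axis site of `J` has a cluster touching the axis unboundedly far to
  the left") when `x` is far to the left.

## References

* H.-O. Georgii, Y. Higuchi, *Percolation and number of phases in the two-dimensional Ising
  model*, J. Math. Phys. 41 (2000) 1153–1169, Lemma 5.2 and Lemma 2.3. [cite: GeorgiiHiguchi2000, Lemma 5.2]
-/

namespace Literature.Probability.LatticeModels

open MeasureTheory SimpleGraph Percolation Zhang Filter Topology
open scoped ENNReal

noncomputable section

/-! ### The pinning event and its deterministic producers -/

section Det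

variable {m L : ℕ} {ω : SpinConfig (Site 2)}

/-- **The pinning event** (left of `Δ`, colour `+`): `x` is joined to a site of `J` by a `+∗`walk
outside `Λ_m` all of whose axis sites lie at columns `< -m`. [cite: GeorgiiHiguchi2000, Lemma 5.2] -/
def PinLeft (m : ℕ) (x : Site 2) (ω : SpinConfig (Site 2)) : Prop :=
  ∃ a ∈ pinJ m ω, ∃ W : zdStarGraph.Walk x a,
    ∀ z ∈ W.support, ω z = 1 ∧ z ∉ box 2 m ∧ (z 1 = 0 → z 0 < -(m : ℤ))

/-- A `J`-site left of `-m` is pinned (trivial walk). [folklore] -/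
theorem pinLeft_of_mem_pinJ {x : Site 2} (hx : x ∈ pinJ m ω) (hx0 : x 1 = 0 → x 0 < -(m : ℤ)) :
    PinLeft m x ω :=
  ⟨x, hx, Walk.nil, fun z hz => by
    rw [Walk.support_nil, List.mem_singleton] at hz
    subst hz
    exact ⟨(pinJ_props hx).1, (pinJ_props hx).2.2, hx0⟩⟩

/-- A `K`-site left of `-m` is pinned. [folklore] -/
theorem pinLeft_of_mem_pinK {x : Site 2} (hx : x ∈ pinK m L ω) (hx0 : x 1 = 0 → x 0 < -(m : ℤ)) :
    PinLeft m x ω :=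
  pinLeft_of_mem_pinJ hx.2 hx0

/-- The vertices of a walk in the open-site graph starting at an open site are open. [folklore] -/
theorem support_subset_of_siteOpenGraph_walk {G : SimpleGraph (Site 2)} {O : Set (Site 2)} {a b : Site 2}
    (p : (siteOpenGraph G O).Walk a b) (ha : a ∈ O) : ∀ v ∈ p.support, v ∈ O := by
  induction p with
  | nil => intro v hv; rw [Walk.support_nil, List.mem_singleton] at hv; subst hv; exact ha
  | cons h p ih =>
    intro v hv
    rw [Walk.support_cons, List.mem_cons] at hv
    rcases hv with rfl | hv
    · exact ha
    · exact ih ((siteOpenGraph_adj _ _ _ _).1 h).2.2 v hv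

/-- **Pinning from the domain** (free far half-axis): if `x` is `+∗`connected inside `pinDom` to a
site `∗`-adjacent to the outside on the upper side, then `PinLeft m x` holds — the walk stays in
the domain (outside `Λ_m`, axis sites left of `-m`) and its last site attaches to an upper crust
site, which belongs to `J`. [cite: GeorgiiHiguchi2000, Lemma 5.2 (proof, "`μ(x ⟷^{+∗} ∞ in (Δ ∪ ℓ_left)ᶜ | F_{Γᶜ}) ≥ μ^ω_Γ(x ⟷^{+∗} σ_max)`")] -/
theorem pinLeft_of_mem_kSet {x : Site 2} (hk : x ∈ kSet (pinDom m L ω) ω 1) : PinLeft m x ω := by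
  obtain ⟨hxΛ, hx1, q, ⟨z, hzΛ, hzside, hqz⟩, ⟨p⟩⟩ := hk
  have hsupp : ∀ v ∈ p.support, ω v = 1 ∧ v ∈ pinDom m L ω := fun v hv => by
    have := support_subset_of_siteOpenGraph_walk p ⟨hx1, Finset.mem_coe.2 hxΛ⟩ v hv
    exact ⟨this.1, Finset.mem_coe.1 this.2⟩
  have hq := hsupp q p.end_mem_support
  have hz1 : 0 ≤ z 1 := by have h := hzside; simp only [OnSide, Units.val_one, one_mul] at h; exact h
  obtain ⟨a, haC, ha1, hqa, -⟩ := exists_attach hq.2 hzΛ hqz hz1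
  have haJ := mem_pinJ_of_mem_pinCrust haC ha1
  refine ⟨a, haJ, (p.mapLe (siteOpenGraph_le zdStarGraph _)).append (Walk.cons hqa Walk.nil), fun v hv => ?_⟩
  rw [Walk.mem_support_append_iff, Walk.support_mapLe_eq_support, Walk.support_cons, Walk.support_nil,
    List.mem_cons, List.mem_singleton] at hv
  rcases hv with hv | rfl | rfl
  · obtain ⟨hv1, hvD⟩ := hsupp v hv
    exact ⟨hv1, fun h => not_mem_pinDom_of_mem_box h hvD, apply_zero_lt_of_mem_pinDom hvD⟩
  · exact ⟨hq.1, fun h => not_mem_pinDom_of_mem_box h hq.2, apply_zero_lt_of_mem_pinDom hq.2⟩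
  · exact ⟨(pinJ_props haJ).1, (pinJ_props haJ).2.2, apply_zero_lt_of_mem_pinJ haJ⟩

/-- **Enclosure by a `K`-arc** (the eye lemma): if two axis sites `u`, `v` on either side of the
axis site `x` are joined by a `∗`-walk of `K`-sites, then `x` belongs to the domain or to `K`
(any lattice walk from the outside of `Λ_L` to `x` through passable sites would cross the arc or
its mirror image at a passable — hence non-blocking — site of `Λ_L`). [cite: GeorgiiHiguchi2000, Lemma 5.2 (proof, "`x` is surrounded by a `+∗`semicircuit")] -/
theorem mem_pinDom_or_pinK_of_starArc {x u v : Site 2} (hx1 : x 1 = 0) (hu1 : u 1 = 0) (hv1 : v 1 = 0)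
    (hux : u 0 < x 0) (hxv : x 0 < v 0) (σ : zdStarGraph.Walk u v)
    (hσ : ∀ z ∈ σ.support, z ∈ pinK m L ω) : x ∈ pinDom m L ω ∨ x ∈ pinK m L ω := by
  by_cases hxK : x ∈ pinKsym m L ω
  · exact Or.inr (mem_pinK_of_mem_pinKsym hxK (by rw [hx1]))
  refine Or.inl (mem_pinDom_iff.2 ⟨?_, fun h => hxK (pinCrust_subset h).1⟩)
  rintro ⟨y, hy, w, hw⟩
  have hxnotK : x ∉ pinK m L ω := fun h => hxK (Or.inl h)
  set σ' : zdStarGraph.Walk u v :=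
    (σ.map (starReflectHom 1)).copy (Rf_eq_self_of_axis hu1) (Rf_eq_self_of_axis hv1) with hσ'
  have hσ'supp : ∀ z ∈ σ'.support, ∃ y ∈ σ.support, z = Rf y := fun z hz => by
    rw [hσ', Walk.support_copy] at hz
    exact mem_support_map_starReflect σ z hz
  have heqx : ∀ {z : Site 2}, z ∈ σ.support → z 0 = x 0 → z 1 ≤ 0 → False := by
    intro z hz h0 h1
    have hz1 := (pinJ_props (hσ z hz).2).2.1
    have : z = x := by
      ext i; fin_cases i
      · exact h0
      · show z 1 = x 1; rw [hx1]; omega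
    exact hxnotK (this ▸ hσ z hz)
  have hα : ∀ z ∈ σ.support, 0 ≤ z 1 ∧ ¬ (x 0 ≤ z 0 ∧ z 0 ≤ x 0 ∧ z 1 ≤ ((0 : ℕ) : ℤ)) :=
    fun z hz => ⟨(pinJ_props (hσ z hz).2).2.1, fun h => heqx hz (le_antisymm h.2.1 h.1) (by simpa using h.2.2)⟩
  have hα' : ∀ z ∈ σ'.support, z 1 ≤ 0 ∧ ¬ (x 0 ≤ z 0 ∧ z 0 ≤ x 0 ∧ -((0 : ℕ) : ℤ) ≤ z 1) := by
    intro z hz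
    obtain ⟨y', hy', rfl⟩ := hσ'supp z hz
    have hy1 := (pinJ_props (hσ y' hy').2).2.1
    refine ⟨by rw [Rf_apply_one]; omega, fun h => ?_⟩
    rw [Rf_apply_zero, Rf_apply_one] at h
    exact heqx hy' (le_antisymm h.2.1 h.1) (by push_cast at h; omega)
  have hH : ∀ z ∈ σ.support, z ∈ box 2 L := fun z hz => (hσ z hz).1
  have hH' : ∀ z ∈ σ'.support, z ∈ box 2 L := by
    intro z hz
    obtain ⟨y', hy', rfl⟩ := hσ'supp z hz
    exact mem_box_Rf_iff.2 (hσ y' hy').1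
  obtain ⟨z, hzw, hz⟩ := exists_mem_support_of_semicircuits hux hxv rfl hu1 rfl hv1 σ hα σ' hα' hH hH'
    (u := x) ⟨le_rfl, le_rfl, by simp [hx1], by simp [hx1]⟩ hy w.reverse
  rw [Walk.support_reverse, List.mem_reverse] at hzw
  have hzP := hw z hzw
  rcases hz with hz | hz
  · exact hzP.elim (fun h => h (hσ z hz).1) (fun h => h (Or.inl (hσ z hz)))
  · obtain ⟨y', hy', rfl⟩ := hσ'supp z hz
    exact hzP.elim (fun h => h (mem_box_Rf_iff.2 (hσ y' hy').1))
      (fun h => h (Or.inr (by rw [Rf_Rf]; exact hσ y' hy')))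

/-- **The semicircuit event** at level `L`: two axis sites on either side of `x` joined by a
`∗`-walk of `K`-sites. [cite: GeorgiiHiguchi2000, Lemma 5.2 (proof)] -/
def SemiLeft (m L : ℕ) (x : Site 2) (ω : SpinConfig (Site 2)) : Prop :=
  ∃ u v : Site 2, u 1 = 0 ∧ v 1 = 0 ∧ u 0 < x 0 ∧ x 0 < v 0 ∧
    ∃ σ : zdStarGraph.Walk u v, ∀ z ∈ σ.support, z ∈ pinK m L ω

/-- On the semicircuit event, `x` lies in the domain or in `K`. [cite: GeorgiiHiguchi2000, Lemma 5.2 (proof)] -/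
theorem mem_pinDom_or_pinK_of_semiLeft {x : Site 2} (hx1 : x 1 = 0) (h : SemiLeft m L x ω) :
    x ∈ pinDom m L ω ∨ x ∈ pinK m L ω := by
  obtain ⟨u, v, hu1, hv1, hux, hxv, σ, hσ⟩ := h
  exact mem_pinDom_or_pinK_of_starArc hx1 hu1 hv1 hux hxv σ hσ

/-- The semicircuit event increases with `L`. [folklore] -/
theorem semiLeft_mono {L L' : ℕ} (hL : L ≤ L') {x : Site 2} (h : SemiLeft m L x ω) : SemiLeft m L' x ω := by
  obtain ⟨u, v, hu1, hv1, hux, hxv, σ, hσ⟩ := h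
  exact ⟨u, v, hu1, hv1, hux, hxv, σ, fun z hz => ⟨box_mono 2 hL (hσ z hz).1, (hσ z hz).2⟩⟩

/-- **The anchoring event**: `J` has an axis site `v` right of `x` whose `∗`cluster in `U` has an
axis site left of `x` (GH: "at least one such point can be found left from `x`, and another such
point can be found right from `x`"). [cite: GeorgiiHiguchi2000, Lemma 5.2 (proof)] -/
def LeftAnchored (m : ℕ) (x : Site 2) (ω : SpinConfig (Site 2)) : Prop :=
  ∃ v ∈ pinJ m ω, v 1 = 0 ∧ x 0 < v 0 ∧ ∃ u ∈ siteCluster zdStarGraph (pinU m ω) v, u 1 = 0 ∧ u 0 < x 0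

/-- A list of sites lies in some box. [folklore] -/
theorem exists_box_of_list (l : List (Site 2)) : ∃ L : ℕ, ∀ z ∈ l, z ∈ box 2 L := by
  induction l with
  | nil => exact ⟨0, fun z hz => by simp at hz⟩
  | cons a l ih =>
    obtain ⟨L, hL⟩ := ih
    refine ⟨L + (a 0).natAbs + (a 1).natAbs, fun z hz => ?_⟩
    rw [List.mem_cons] at hz
    rcases hz with rfl | hz
    · refine mem_box.2 fun i => ?_
      have hL0 : (0 : ℤ) ≤ L := by positivity
      have := le_abs_self (z 0); have := neg_abs_le (z 0); have := le_abs_self (z 1); have := neg_abs_le (z 1)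
      fin_cases i <;> push_cast <;> constructor <;> linarith
    · exact box_mono 2 (by omega) (hL z hz)

/-- The anchoring event gives the semicircuit event at some level `L` (a walk inside the cluster,
all of whose sites are `J`-sites). [cite: GeorgiiHiguchi2000, Lemma 5.2 (proof)] -/
theorem exists_semiLeft_of_leftAnchored {x : Site 2} (h : LeftAnchored m x ω) : ∃ L, SemiLeft m L x ω := by
  classical
  obtain ⟨v, hv, hv1, hxv, u, hu, hu1, hux⟩ := h
  have hvv : v ∈ siteCluster zdStarGraph (pinU m ω) v := (mem_siteCluster_self_iff _ _ _).2 (mem_pinU_of_mem_pinJ hv)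
  obtain ⟨p, hp⟩ := exists_walk_in_siteCluster hu hvv
  obtain ⟨L, hL⟩ := exists_box_of_list p.support
  exact ⟨L, u, v, hu1, hv1, hux, hxv, p, fun z hz => ⟨hL z hz, mem_pinJ_of_mem_cluster hv (hp z hz)⟩⟩

/-- **Anchoring from `-k`**: an axis `J`-site at a column `> -k` whose cluster in `U` has axis sites
arbitrarily far to the left. [cite: GeorgiiHiguchi2000, Lemma 5.2 (hypothesis: "`I^{+∗}_up` meets `ℓ_right` infinitely often")] -/
def LeftAnchoredFrom (m k : ℕ) (ω : SpinConfig (Site 2)) : Prop :=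
  ∃ v ∈ pinJ m ω, v 1 = 0 ∧ -(k : ℤ) < v 0 ∧
    ∀ N : ℕ, ∃ u ∈ siteCluster zdStarGraph (pinU m ω) v, u 1 = 0 ∧ u 0 < -(N : ℤ)

/-- **Anchoring at infinity**: an axis `J`-site whose cluster in `U` has axis sites arbitrarily far
to the left. [cite: GeorgiiHiguchi2000, Lemma 5.2 (hypothesis)] -/
def LeftAnchoredInf (m : ℕ) (ω : SpinConfig (Site 2)) : Prop :=
  ∃ v ∈ pinJ m ω, v 1 = 0 ∧ ∀ N : ℕ, ∃ u ∈ siteCluster zdStarGraph (pinU m ω) v, u 1 = 0 ∧ u 0 < -(N : ℤ)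

/-- Anchoring from `-k` anchors every axis site at columns `≤ -k`. [folklore] -/
theorem leftAnchored_of_leftAnchoredFrom {k : ℕ} {x : Site 2} (hx0 : x 0 ≤ -(k : ℤ))
    (h : LeftAnchoredFrom m k ω) : LeftAnchored m x ω := by
  obtain ⟨v, hv, hv1, hvk, hN⟩ := h
  obtain ⟨u, hu, hu1, huN⟩ := hN (-(x 0)).toNat
  exact ⟨v, hv, hv1, by omega, u, hu, hu1, by omega⟩

/-- The events `LeftAnchoredFrom m k` increase with `k`. [folklore] -/
theorem leftAnchoredFrom_mono {k k' : ℕ} (hk : k ≤ k') (h : LeftAnchoredFrom m k ω) : LeftAnchoredFrom m k' ω := by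
  obtain ⟨v, hv, hv1, hvk, hN⟩ := h
  exact ⟨v, hv, hv1, by omega, hN⟩

/-- Anchoring at infinity is anchoring from some `-k`. [folklore] -/
theorem exists_leftAnchoredFrom_of_leftAnchoredInf (h : LeftAnchoredInf m ω) : ∃ k, LeftAnchoredFrom m k ω := by
  obtain ⟨v, hv, hv1, hN⟩ := h
  exact ⟨(-(v 0)).toNat + 1, v, hv, hv1, by omega, hN⟩

end Det

/-! ### Measurability -/

section Meas

variable {m L : ℕ}

/-- The event "there is a `∗`-walk from `u` to `v` through sites satisfying a measurable
site-property" is measurable. [folklore] -/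
theorem measurableSet_exists_starWalk {P : Site 2 → SpinConfig (Site 2) → Prop}
    (hP : ∀ z, MeasurableSet {ω | P z ω}) (u v : Site 2) :
    MeasurableSet {ω : SpinConfig (Site 2) | ∃ σ : zdStarGraph.Walk u v, ∀ z ∈ σ.support, P z ω} := by
  have : {ω : SpinConfig (Site 2) | ∃ σ : zdStarGraph.Walk u v, ∀ z ∈ σ.support, P z ω} =
      ⋃ l : List (Site 2), ⋃ (_ : ∃ σ : zdStarGraph.Walk u v, σ.support = l), ⋂ z ∈ l, {ω | P z ω} := by
    ext ω
    simp only [Set.mem_setOf_eq, Set.mem_iUnion, Set.mem_iInter, exists_prop]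
    constructor
    · rintro ⟨σ, hσ⟩; exact ⟨σ.support, ⟨σ, rfl⟩, hσ⟩
    · rintro ⟨l, ⟨σ, rfl⟩, h⟩; exact ⟨σ, h⟩
  rw [this]
  exact MeasurableSet.iUnion fun l => MeasurableSet.iUnion fun _ =>
    MeasurableSet.biInter (Set.to_countable _) fun z _ => hP z

/-- `{z ∈ K}` is measurable. [folklore] -/
theorem measurableSet_mem_pinK (z : Site 2) : MeasurableSet {ω : SpinConfig (Site 2) | z ∈ pinK m L ω} := by
  by_cases hz : z ∈ box 2 L
  · have : {ω : SpinConfig (Site 2) | z ∈ pinK m L ω} = {ω | z ∈ pinJ m ω} := by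
      ext ω; exact ⟨fun h => h.2, fun h => ⟨hz, h⟩⟩
    rw [this]; exact measurableSet_mem_pinJ m z
  · have : {ω : SpinConfig (Site 2) | z ∈ pinK m L ω} = ∅ := by
      ext ω; exact ⟨fun h => hz h.1, fun h => h.elim⟩
    rw [this]; exact MeasurableSet.empty

/-- The semicircuit event is measurable. [folklore] -/
theorem measurableSet_semiLeft (x : Site 2) : MeasurableSet {ω : SpinConfig (Site 2) | SemiLeft m L x ω} := by
  have : {ω : SpinConfig (Site 2) | SemiLeft m L x ω} = ⋃ u : Site 2, ⋃ v : Site 2,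
      ⋃ (_ : u 1 = 0 ∧ v 1 = 0 ∧ u 0 < x 0 ∧ x 0 < v 0),
        {ω | ∃ σ : zdStarGraph.Walk u v, ∀ z ∈ σ.support, z ∈ pinK m L ω} := by
    ext ω
    simp only [SemiLeft, Set.mem_setOf_eq, Set.mem_iUnion, exists_prop]
    constructor
    · rintro ⟨u, v, h1, h2, h3, h4, h⟩; exact ⟨u, v, ⟨h1, h2, h3, h4⟩, h⟩
    · rintro ⟨u, v, ⟨h1, h2, h3, h4⟩, h⟩; exact ⟨u, v, h1, h2, h3, h4, h⟩
  rw [this]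
  exact MeasurableSet.iUnion fun u => MeasurableSet.iUnion fun v => MeasurableSet.iUnion fun _ =>
    measurableSet_exists_starWalk (fun z => measurableSet_mem_pinK z) u v

/-- `{u ∈ C_U(v)}` is measurable. [folklore] -/
theorem measurableSet_mem_siteCluster_pinU (v u : Site 2) :
    MeasurableSet {ω : SpinConfig (Site 2) | u ∈ siteCluster zdStarGraph (pinU m ω) v} :=
  measurable_pinU m (measurableSet_mem_siteCluster (G := zdStarGraph) v u)

/-- The anchoring events are measurable. [folklore] -/
theorem measurableSet_leftAnchoredFrom (k : ℕ) : MeasurableSet {ω : SpinConfig (Site 2) | LeftAnchoredFrom m k ω} := by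
  have : {ω : SpinConfig (Site 2) | LeftAnchoredFrom m k ω} = ⋃ v : Site 2, ⋃ (_ : v 1 = 0 ∧ -(k : ℤ) < v 0),
      {ω | v ∈ pinJ m ω} ∩ ⋂ N : ℕ, ⋃ u : Site 2, ⋃ (_ : u 1 = 0 ∧ u 0 < -(N : ℤ)),
        {ω | u ∈ siteCluster zdStarGraph (pinU m ω) v} := by
    ext ω
    simp only [LeftAnchoredFrom, Set.mem_setOf_eq, Set.mem_iUnion, Set.mem_iInter, Set.mem_inter_iff, exists_prop]
    constructor
    · rintro ⟨v, hv, hv1, hvk, hN⟩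
      exact ⟨v, ⟨hv1, hvk⟩, hv, fun N => by obtain ⟨u, hu, hu1, huN⟩ := hN N; exact ⟨u, ⟨hu1, huN⟩, hu⟩⟩
    · rintro ⟨v, ⟨hv1, hvk⟩, hv, hN⟩
      exact ⟨v, hv, hv1, hvk, fun N => by obtain ⟨u, ⟨hu1, huN⟩, hu⟩ := hN N; exact ⟨u, hu, hu1, huN⟩⟩
  rw [this]
  exact MeasurableSet.iUnion fun v => MeasurableSet.iUnion fun _ => (measurableSet_mem_pinJ m v).inter
    (MeasurableSet.iInter fun N => MeasurableSet.iUnion fun u => MeasurableSet.iUnion fun _ =>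
      measurableSet_mem_siteCluster_pinU v u)

/-- The anchoring event at infinity is measurable. [folklore] -/
theorem measurableSet_leftAnchoredInf : MeasurableSet {ω : SpinConfig (Site 2) | LeftAnchoredInf m ω} := by
  have : {ω : SpinConfig (Site 2) | LeftAnchoredInf m ω} = ⋃ k : ℕ, {ω | LeftAnchoredFrom m k ω} := by
    ext ω
    simp only [Set.mem_setOf_eq, Set.mem_iUnion]
    exact ⟨exists_leftAnchoredFrom_of_leftAnchoredInf, fun ⟨k, v, hv, hv1, _, hN⟩ => ⟨v, hv, hv1, hN⟩⟩
  rw [this]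
  exact MeasurableSet.iUnion fun k => measurableSet_leftAnchoredFrom k

/-- The pinning event is measurable. [folklore] -/
theorem measurableSet_pinLeft (x : Site 2) : MeasurableSet {ω : SpinConfig (Site 2) | PinLeft m x ω} := by
  have : {ω : SpinConfig (Site 2) | PinLeft m x ω} = ⋃ a : Site 2, {ω | a ∈ pinJ m ω} ∩
      {ω | ∃ W : zdStarGraph.Walk x a, ∀ z ∈ W.support, ω z = 1 ∧ z ∉ box 2 m ∧ (z 1 = 0 → z 0 < -(m : ℤ))} := by
    ext ω
    simp only [PinLeft, Set.mem_setOf_eq, Set.mem_iUnion, Set.mem_inter_iff]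
  rw [this]
  refine MeasurableSet.iUnion fun a => (measurableSet_mem_pinJ m a).inter
    (measurableSet_exists_starWalk (fun z => ?_) x a)
  exact (measurableSet_eq_one (V := Site 2) z).inter (MeasurableSet.const _)

/-- `{x ∈ kSet (pinDom) 1}` is measurable. [folklore] -/
theorem measurableSet_mem_kSet_pinDom (x : Site 2) :
    MeasurableSet {ω : SpinConfig (Site 2) | x ∈ kSet (pinDom m L ω) ω 1} := by
  have : {ω : SpinConfig (Site 2) | x ∈ kSet (pinDom m L ω) ω 1} =
      ⋃ G : Finset (Site 2), {ω | pinDom m L ω = G} ∩ {σ | x ∈ kSet G σ 1} := by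
    ext ω
    simp only [Set.mem_setOf_eq, Set.mem_iUnion, Set.mem_inter_iff]
    exact ⟨fun h => ⟨_, rfl, h⟩, fun ⟨G, hG, h⟩ => by rw [hG]; exact h⟩
  rw [this]
  exact MeasurableSet.iUnion fun G => (measurableSet_pinDom_eq m L G).inter (measurableSet_kSet G x 1)

end Meas

/-! ### The strong Markov step -/

section Prob

variable {β : ℝ} {μ : Measure (SpinConfig (Site 2))}

/-- `{x ∈ kSet Λ · 1}` is an increasing event. [folklore] -/
theorem isUpperSet_kSet (Λ : Finset (Site 2)) (x : Site 2) :
    IsUpperSet {σ : SpinConfig (Site 2) | x ∈ kSet Λ σ 1} := by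
  intro σ τ hστ hσ
  exact kSet_mono (fun v hv => le_antisymm (intUnits_le_one _) (hv ▸ hστ v)) hσ

/-- **The strong Markov step of the pinning lemma**: for `β ≥ 0`, `μ, μ' ∈ 𝒢(β, 0)` and an axis
site `x`, `μ'(x ⟷^{+∗} ∞)/2 · μ(x ∈ Γ) ≤ μ(x ∈ kSet Γ 1)` for the exploration pinning domain
`Γ = pinDom m L`: by the strong Markov property at the outside-determined `Γ`, on `{x ∈ Γ}` the
conditional probability that `x` is `+∗`connected inside `Γ` to its upper boundary is
`μ^ω_Γ(x ∈ kSet Γ 1) ≥ μ^{η±}_Γ(x ∈ kSet Γ 1) ≥ θ/2` (the boundary condition `ω` is `+` on the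
upper boundary of `Γ`, which lies in `J`; point-to-semicircuit lemma in the symmetric hole-free
`Γ`). [cite: GeorgiiHiguchi2000, Lemma 5.2 (proof, display with `θ/4`)] -/
theorem measureReal_kSet_pinDom_ge (hβ : 0 ≤ β) (hμ : μ ∈ isingGibbsMeasures 2 β 0)
    {μ' : Measure (SpinConfig (Site 2))} (hμ' : μ' ∈ isingGibbsMeasures 2 β 0) (m L : ℕ)
    {x : Site 2} (hx1 : x 1 = 0) :
    μ'.real {ω | (siteCluster zdStarGraph (spinSites 1 ω) x).Infinite} / 2 * μ.real {ω | x ∈ pinDom m L ω} ≤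
      μ.real {ω | x ∈ kSet (pinDom m L ω) ω 1} := by
  classical
  have hμG : IsGibbsMeasure (isingSpecification (zdGraph 2) β 0) μ := hμ
  haveI := hμG.isProbabilityMeasure
  have hγ : IsSpecification (isingSpecification (zdGraph 2) β 0) :=
    isSpecification_isingSpecification_zd_holds 2 β 0
  set θ := μ'.real {ω | (siteCluster zdStarGraph (spinSites 1 ω) x).Infinite} with hθ
  have hθ0 : 0 ≤ θ / 2 := by positivity
  set D : Set (SpinConfig (Site 2)) := {ω | x ∈ pinDom m L ω} with hD
  set E : Set (SpinConfig (Site 2)) := {ω | x ∈ kSet (pinDom m L ω) ω 1} with hE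
  have hDm : MeasurableSet D := measurableSet_mem_pinDom m L x
  have hEm : MeasurableSet E := measurableSet_mem_kSet_pinDom x
  have hED : E ⊆ D := fun ω hω => hω.1
  -- strong Markov at `Γ = pinDom m L`
  have hSM := hμG.setLIntegral_strongMarkov hγ (Γ := fun ω => pinDom m L ω)
    (measurableSet_cylinderEvents_pinDom_eq m L) {G | x ∈ G} (f := E.indicator 1)
    (measurable_one.indicator hEm)
  have hset : {ω : SpinConfig (Site 2) | pinDom m L ω ∈ {G : Finset (Site 2) | x ∈ G}} = D := rfl
  simp only [hset] at hSM
  have hlhs : ∫⁻ ω in D, E.indicator 1 ω ∂μ = μ E := by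
    rw [lintegral_indicator_one hEm, Measure.restrict_apply hEm, Set.inter_eq_left.2 hED]
  -- the kernel bound on `D`
  have hker : ∀ ω ∈ D, ENNReal.ofReal (θ / 2) ≤
      ∫⁻ σ, E.indicator 1 σ ∂(isingSpecification (zdGraph 2) β 0 (pinDom m L ω) ω) := by
    intro ω hω
    rw [lintegral_indicator_one hEm, isingSpecification_apply]
    set G := pinDom m L ω with hG
    set B : Set (SpinConfig (Site 2)) := {σ | x ∈ kSet G σ 1} with hB
    have hBm : MeasurableSet B := measurableSet_kSet G x 1
    -- `E` agrees with `B` almost surely under the kernel (outside-determination of `Γ`)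
    have hEB : (isingMeasure (zdGraph 2) G β 0 (.fixed ω)) E = (isingMeasure (zdGraph 2) G β 0 (.fixed ω)) B := by
      refine measure_congr ?_
      filter_upwards [ae_isingMeasure_fixed_eq_outside (zdGraph 2) G β 0 ω] with σ hσ
      have hΓσ : pinDom m L σ = G := pinDom_eq_of_agree fun v hv => hσ v hv
      show (x ∈ kSet (pinDom m L σ) σ 1) = (x ∈ kSet G σ 1)
      rw [hΓσ]
    rw [hEB]
    -- point-to-semicircuit in `G` with `η±` boundary condition
    have hPTS := pointToSemicircuit hβ (Λ := G) (fun z => (pinDom_Rf_iff (m := m) (L := L) (ω := ω) (z := z)).symm)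
      (fun z hz => farRight_of_not_mem_pinDom hz) hω hx1 hμ'
    -- monotonicity in the boundary condition
    have hle : ∀ z ∈ outerBoundary (zdGraph 2) G, pmBC 0 z ≤ ω z := by
      intro z hz
      rw [mem_outerBoundary_iff] at hz
      obtain ⟨hzG, y, hy, hadj⟩ := hz
      have hzC : z ∈ pinCrust m L ω := adj_pinDom_mem_pinCrust hy hzG hadj.symm
      rcases le_or_gt 0 (z 1) with h1 | h1
      · rw [(pinJ_props (mem_pinJ_of_mem_pinCrust hzC h1)).1]; exact intUnits_le_one _
      · rw [pmBC_of_lt h1]; exact neg_one_le_intUnits _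
    have hmonoB : Monotone (B.indicator (1 : SpinConfig (Site 2) → ℝ)) :=
      monotone_indicator_one_of_isUpperSet (isUpperSet_kSet G x)
    have hdepB : ∀ σ σ' : SpinConfig (Site 2), (∀ z ∈ G, σ z = σ' z) →
        B.indicator (1 : SpinConfig (Site 2) → ℝ) σ = B.indicator 1 σ' := fun σ σ' h => by
      have hiff : σ ∈ B ↔ σ' ∈ B := by
        show x ∈ kSet G σ 1 ↔ x ∈ kSet G σ' 1
        rw [kSet_eq_of_eqOn (Λ := G) (c := σ) (c' := σ') h 1]
      by_cases hσ : σ ∈ B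
      · rw [Set.indicator_of_mem hσ, Set.indicator_of_mem (hiff.1 hσ)]; rfl
      · rw [Set.indicator_of_notMem hσ, Set.indicator_of_notMem (fun h' => hσ (hiff.2 h'))]
    have hexp : ∀ bc : BoundaryCondition (Site 2), isingExpect (zdGraph 2) G β 0 bc (B.indicator 1) =
        (isingMeasure (zdGraph 2) G β 0 bc).real B := fun bc => integral_indicator_one hBm
    have hcmp : (isingMeasure (zdGraph 2) G β 0 (.fixed (pmBC 0))).real B ≤
        (isingMeasure (zdGraph 2) G β 0 (.fixed ω)).real B := by
      rw [← hexp, ← hexp]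
      exact isingExpect_fixed_le_of_le_on_outerBoundary hβ G 0 hle hmonoB (measurable_one.indicator hBm) hdepB
    calc ENNReal.ofReal (θ / 2) ≤ ENNReal.ofReal ((isingMeasure (zdGraph 2) G β 0 (.fixed ω)).real B) :=
          ENNReal.ofReal_le_ofReal (hPTS.trans hcmp)
      _ = (isingMeasure (zdGraph 2) G β 0 (.fixed ω)) B := ofReal_measureReal
  -- assemble
  have hmain : ENNReal.ofReal (θ / 2) * μ D ≤ μ E := by
    calc ENNReal.ofReal (θ / 2) * μ D = ∫⁻ _ in D, ENNReal.ofReal (θ / 2) ∂μ := by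
          rw [setLIntegral_const]
      _ ≤ ∫⁻ ω in D, ∫⁻ σ, E.indicator 1 σ ∂(isingSpecification (zdGraph 2) β 0 (pinDom m L ω) ω) ∂μ :=
          setLIntegral_mono' hDm hker
      _ = ∫⁻ ω in D, E.indicator 1 ω ∂μ := hSM.symm
      _ = μ E := hlhs
  have h := (ENNReal.toReal_le_toReal (by finiteness) (by finiteness)).2 hmain
  rw [ENNReal.toReal_mul, ENNReal.toReal_ofReal hθ0] at h
  exact h

/-- **The pinning bound** (Georgii–Higuchi 2000, Lemma 5.2, quantitative core): for `β ≥ 0`,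
`μ, μ' ∈ 𝒢(β, 0)`, an axis site `x` with `x₁ < -m` and any `L`,
`μ'(x ⟷^{+∗} ∞)/2 · μ(SemiLeft m L x) ≤ 2 μ(PinLeft m x)`. [cite: GeorgiiHiguchi2000, Lemma 5.2] -/
theorem measureReal_pinLeft_ge (hβ : 0 ≤ β) (hμ : μ ∈ isingGibbsMeasures 2 β 0)
    {μ' : Measure (SpinConfig (Site 2))} (hμ' : μ' ∈ isingGibbsMeasures 2 β 0) (m L : ℕ)
    {x : Site 2} (hx1 : x 1 = 0) (hx0 : x 0 < -(m : ℤ)) :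
    μ'.real {ω | (siteCluster zdStarGraph (spinSites 1 ω) x).Infinite} / 2 * μ.real {ω | SemiLeft m L x ω} ≤
      2 * μ.real {ω | PinLeft m x ω} := by
  have hμG : IsGibbsMeasure (isingSpecification (zdGraph 2) β 0) μ := hμ
  haveI := hμG.isProbabilityMeasure
  haveI : IsProbabilityMeasure μ' := (show IsGibbsMeasure (isingSpecification (zdGraph 2) β 0) μ' from hμ').isProbabilityMeasure
  set θ := μ'.real {ω | (siteCluster zdStarGraph (spinSites 1 ω) x).Infinite} with hθ
  have hθ0 : 0 ≤ θ / 2 := by positivity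
  have hθ1 : θ / 2 ≤ 1 := by
    have : θ ≤ 1 := measureReal_le_one
    linarith [measureReal_nonneg (μ := μ') (s := {ω | (siteCluster zdStarGraph (spinSites 1 ω) x).Infinite})]
  -- (I1) `K`-sites are pinned
  have h1 : μ.real {ω | x ∈ pinK m L ω} ≤ μ.real {ω | PinLeft m x ω} :=
    measureReal_mono fun ω hω => pinLeft_of_mem_pinK hω fun _ => hx0
  -- (I3) `kSet`-sites are pinned
  have h3 : μ.real {ω | x ∈ kSet (pinDom m L ω) ω 1} ≤ μ.real {ω | PinLeft m x ω} :=
    measureReal_mono fun ω hω => pinLeft_of_mem_kSet hω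
  -- (I2) the strong Markov step
  have h2 := measureReal_kSet_pinDom_ge hβ hμ hμ' m L hx1
  -- the semicircuit event is contained in `{x ∈ Dom} ∪ {x ∈ K}`
  have h4 : μ.real {ω | SemiLeft m L x ω} ≤ μ.real {ω | x ∈ pinDom m L ω} + μ.real {ω | x ∈ pinK m L ω} := by
    calc μ.real {ω | SemiLeft m L x ω} ≤ μ.real ({ω | x ∈ pinDom m L ω} ∪ {ω | x ∈ pinK m L ω}) :=
          measureReal_mono fun ω hω => mem_pinDom_or_pinK_of_semiLeft hx1 hω
      _ ≤ _ := measureReal_union_le _ _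
  have hK0 := measureReal_nonneg (μ := μ) (s := {ω | x ∈ pinK m L ω})
  calc θ / 2 * μ.real {ω | SemiLeft m L x ω}
      ≤ θ / 2 * μ.real {ω | x ∈ pinDom m L ω} + θ / 2 * μ.real {ω | x ∈ pinK m L ω} := by
        rw [← mul_add]; exact mul_le_mul_of_nonneg_left h4 hθ0
    _ ≤ μ.real {ω | PinLeft m x ω} + μ.real {ω | PinLeft m x ω} := by
        gcongr
        · exact h2.trans h3
        · calc θ / 2 * μ.real {ω | x ∈ pinK m L ω} ≤ 1 * μ.real {ω | x ∈ pinK m L ω} :=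
              mul_le_mul_of_nonneg_right hθ1 hK0
            _ ≤ _ := by rw [one_mul]; exact h1
    _ = 2 * μ.real {ω | PinLeft m x ω} := by ring

/-! ### The semicircuit event is likely -/

/-- **Eventually in `L`, the semicircuit event is nearly as likely as anchoring.** [cite: GeorgiiHiguchi2000, Lemma 5.2 (proof: "If `Λ` is large enough, a semicircuit `σ` as above can be found within `Λ` with probability still larger than `1/2`")] -/
theorem measureReal_semiLeft_eventually_ge (hμ : μ ∈ isingGibbsMeasures 2 β 0) (m : ℕ) (x : Site 2)
    {ε : ℝ} (hε : 0 < ε) :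
    ∃ L₀ : ℕ, ∀ L, L₀ ≤ L → μ.real {ω | LeftAnchored m x ω} - ε ≤ μ.real {ω | SemiLeft m L x ω} := by
  have hμG : IsGibbsMeasure (isingSpecification (zdGraph 2) β 0) μ := hμ
  haveI := hμG.isProbabilityMeasure
  have hmono : Monotone fun L => {ω : SpinConfig (Site 2) | SemiLeft m L x ω} :=
    fun L L' hL ω hω => semiLeft_mono hL hω
  have hlim : Tendsto (fun L => μ {ω | SemiLeft m L x ω}) atTop (𝓝 (μ (⋃ L : ℕ, {ω | SemiLeft m L x ω}))) :=
    tendsto_measure_iUnion_atTop hmono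
  have hlim' : Tendsto (fun L => μ.real {ω | SemiLeft m L x ω}) atTop
      (𝓝 ((μ (⋃ L : ℕ, {ω | SemiLeft m L x ω})).toReal)) :=
    (ENNReal.tendsto_toReal (measure_ne_top _ _)).comp hlim
  have hge : μ.real {ω | LeftAnchored m x ω} ≤ (μ (⋃ L : ℕ, {ω | SemiLeft m L x ω})).toReal := by
    refine ENNReal.toReal_mono (measure_ne_top _ _) (measure_mono fun ω hω => ?_)
    obtain ⟨L, hL⟩ := exists_semiLeft_of_leftAnchored hω
    exact Set.mem_iUnion.2 ⟨L, hL⟩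
  have hev := hlim'.eventually (Ioi_mem_nhds (show (μ (⋃ L : ℕ, {ω | SemiLeft m L x ω})).toReal - ε <
    (μ (⋃ L : ℕ, {ω | SemiLeft m L x ω})).toReal by linarith))
  obtain ⟨L₀, hL₀⟩ := eventually_atTop.1 hev
  exact ⟨L₀, fun L hL => by
    have h' : (μ (⋃ L : ℕ, {ω | SemiLeft m L x ω})).toReal - ε < μ.real {ω | SemiLeft m L x ω} := hL₀ L hL
    linarith⟩

/-- **Anchoring is likely far to the left**: for every `ε > 0` there is `N₀` with
`μ(LeftAnchored m x) ≥ μ(LeftAnchoredInf m) - ε` for all axis sites `x` with `x₁ ≤ -N₀`. [cite: GeorgiiHiguchi2000, Lemma 5.2 (proof: "if `x` is located far enough … with probability exceeding `1/2`")] -/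
theorem measureReal_leftAnchored_ge (hμ : μ ∈ isingGibbsMeasures 2 β 0) (m : ℕ) {ε : ℝ} (hε : 0 < ε) :
    ∃ N₀ : ℕ, ∀ x : Site 2, x 0 ≤ -(N₀ : ℤ) →
      μ.real {ω | LeftAnchoredInf m ω} - ε ≤ μ.real {ω | LeftAnchored m x ω} := by
  have hμG : IsGibbsMeasure (isingSpecification (zdGraph 2) β 0) μ := hμ
  haveI := hμG.isProbabilityMeasure
  set R : ℕ → Set (SpinConfig (Site 2)) := fun k => {ω | LeftAnchoredFrom m k ω} with hR
  have hRmono : Monotone R := fun k k' hk ω hω => leftAnchoredFrom_mono hk hω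
  have hRU : (⋃ k, R k) = {ω | LeftAnchoredInf m ω} := by
    ext ω
    simp only [Set.mem_iUnion, hR, Set.mem_setOf_eq]
    exact ⟨fun ⟨k, v, hv, hv1, _, hN⟩ => ⟨v, hv, hv1, hN⟩, exists_leftAnchoredFrom_of_leftAnchoredInf⟩
  have hlim : Tendsto (fun k => μ (R k)) atTop (𝓝 (μ {ω | LeftAnchoredInf m ω})) := by
    rw [← hRU]; exact tendsto_measure_iUnion_atTop hRmono
  have hlim' : Tendsto (fun k => μ.real (R k)) atTop (𝓝 (μ.real {ω | LeftAnchoredInf m ω})) :=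
    (ENNReal.tendsto_toReal (measure_ne_top _ _)).comp hlim
  obtain ⟨N₀, hN₀⟩ := eventually_atTop.1 (hlim'.eventually (Ioi_mem_nhds
    (show μ.real {ω | LeftAnchoredInf m ω} - ε < μ.real {ω | LeftAnchoredInf m ω} by linarith)))
  refine ⟨N₀, fun x hx0 => ?_⟩
  have hRN : μ.real {ω | LeftAnchoredInf m ω} - ε < μ.real (R N₀) := hN₀ N₀ le_rfl
  have hsub : μ.real (R N₀) ≤ μ.real {ω | LeftAnchored m x ω} :=
    measureReal_mono fun ω hω => leftAnchored_of_leftAnchoredFrom hx0 hω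
  linarith

end Prob

end

end Literature.Probability.LatticeModels
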